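import Literature.AnabelianGeometry.SemiGraphs.PSCCuspidalCriterionProofs
import Literature.AnabelianGeometry.SemiGraphs.PSCGraphicityEasyDirections
import HarnessLib

/-!
# [CombGC] Theorem 1.6 (ii), the step "edge-wise filtration-preserving ⟹ group-theoretically edge-like"

Mochizuki, *A combinatorial version of the Grothendieck conjecture*, Tohoku Math. J. **59** (2007)
[CombGC], §1, proof of Theorem 1.6 (ii), author's manuscript p. 14: "we may assume, without loss of
generality, that `G`, `H` are noncuspidal and sturdy. Also, as in the proof of assertion (i), we may
assume that `Σ = {l}`. … But by Remark 1.4.4, the assumption that `α` is edge-wise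
filtration-preserving implies that `α` is group-theoretically edge-like."  Remark 1.4.4 is used in
its AMENDED form [IUTchI] Remark 1.2.3 (v) (kurims manuscript p. 43): "the nodal edge-like subgroups
of `Π_G` may be characterized as the maximal closed subgroups `A ≅ ℤ_l` which satisfy …: for every
characteristic open subgroup `Π_{G'} ⊆ Π_G`, … `Π_{G''} := A · Π_{G'}`, … the cyclic finite étale
covering `G' → G''` is nodally totally ramified.  Here, we note further that … `G' → G''` is nodally
totally ramified if and only if it is module-wise nodal."

Proof-only companion of `PSCGraphicity.lean` / `PSCRamification.lean` (abc-iut-L3-t4), seat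
abc-iut-w4-d052 (cone row `CombGC:Thm1.6`), in the pattern of `PSCCuspidalCriterionProofs.lean`
(Thm. 1.6 (i)): over the interface `PSCDatum Π`, for noncuspidal data `G`, `H` with
`Σ_G = Σ_H = {l}` and compact `Π_G`, `Π_H`, an EDGE-WISE FILTRATION-PRESERVING `α : Π_G ≅ Π_H`
transports the condition of Rmk. 1.2.3 (v): "module-wise nodal" is a statement about the inverse
images of `M^cusp ⊆ M^edge` which `α` carries along (Def. 1.4 (iii)), and "nodally totally ramified
⟺ module-wise nodal" is PROVED for every datum (`PSCDatum.nodallyTotallyRamified_iff_modulewiseNodal`,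
abc-iut-L3-t4).  Hence, granting the characterization itself (first conjunct of the named fact
`PSCDatum.NodalEdgeLikeCharacterization`, for `G` and for `H`), `α` is group-theoretically edge-like:
**`PSCDatum.isGroupTheoreticallyEdgeLike_of_isEdgewiseFiltrationPreserving`**.

Honest scope: `Σ = {l}`, noncuspidal, compact — the reductions print performs first ("replace `G`,
`H` by their compactifications", "we may assume `Σ = {l}`") are change-of-datum functors the
interface does not carry (cell GAP-LEDGER G-w4d052-1); and for the TRIVIAL coverings (`A ⊆ Π_{G'}`)
the condition only records that the base has a node, so "`G` has a node ⟹ `H` has a node" enters as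
the displayed hypothesis `hn` (it is print's `n(G) = n(H)` for corresponding coverings, Rmk. 1.4.2,
itself a consequence of the origin).  Nothing here takes a side on [IUTchIII] Cor. 3.12.
[cite: MochizukiCombGC2007, Thm 1.6(ii) p.14] [cite: Mochizuki2012, IUTchI Rmk 1.2.3(v) p.43]
-/

noncomputable section

namespace Literature.AnabelianGeometry.SemiGraphs

namespace PSCDatum

open scoped Pointwise

universe u

variable {P : Type u} [Group P] [TopologicalSpace P] [IsTopologicalGroup P]
variable {P' : Type u} [Group P'] [TopologicalSpace P'] [IsTopologicalGroup P']
variable {G : PSCDatum P} {H : PSCDatum P'} {α : P ≃ₜ* P'}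

/-! ### Edge-wise filtration-preservation is symmetric -/

/-- If `α` is edge-wise filtration-preserving then so is `α⁻¹`. [cite: MochizukiCombGC2007, Def 1.4(iii) p.10] -/
theorem IsEdgewiseFiltrationPreserving.symm (h : G.IsEdgewiseFiltrationPreserving H α) :
    H.IsEdgewiseFiltrationPreserving G α.symm := by
  intro U' hU'
  have hU := isOpen_comap α U' hU'
  have key := h _ hU
  rw [Subgroup.map_comap_eq_self_of_surjective α.surjective] at key
  have key' := congrArg (Subgroup.comap α.toMulEquiv.toMonoidHom) key
  rw [Subgroup.comap_map_eq_self_of_injective α.injective] at key'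
  rw [map_symm_eq_comap α, map_symm_eq_comap α]
  exact key'.symm

/-! ### Transport of "`G_U → G_{A·U}` is nodally totally ramified" along an edge-wise filtration-preserving `α` -/

/-- **The key transport** ([CombGC] p. 14 "by Remark 1.4.4 …", amended [IUTchI] Rmk. 1.2.3 (v)):
for noncuspidal `G`, `H` with `Σ_G = Σ_H = {l}`, compact `Π_G`, `Π_H`, `α` edge-wise
filtration-preserving, `A = \overline{⟨a⟩}` closed, infinite, topologically cyclic and `U`
characteristic open in `Π_G`: if `G_U → G_{A·U}` is nodally totally ramified then so is
`H_{α U} → H_{α A · α U}` — through "nodally totally ramified ⟺ module-wise nodal" on both sides.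
[cite: Mochizuki2012, IUTchI Rmk 1.2.3(v) p.43] -/
theorem nodalClause_map [CompactSpace P] [CompactSpace P'] {l : ℕ} (hS : G.Sigma = {l})
    (hS' : H.Sigma = {l}) (hG0 : G.graph.IsNoncuspidal) (hH0 : H.graph.IsNoncuspidal)
    (hn : Nonempty G.graph.N → Nonempty H.graph.N) (hfp : G.IsEdgewiseFiltrationPreserving H α)
    {A U : Subgroup P} (hAc : IsClosed (A : Set P)) {a : P}
    (hA : (Subgroup.zpowers a).topologicalClosure = A) (hAinf : (A : Set P).Infinite)
    (hU : U.Characteristic) (hUo : IsOpen (U : Set P)) (h : G.IsNodallyTotallyRamified (A ⊔ U) U) :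
    H.IsNodallyTotallyRamified
      (A.map α.toMulEquiv.toMonoidHom ⊔ U.map α.toMulEquiv.toMonoidHom)
      (U.map α.toMulEquiv.toMonoidHom) := by
  haveI : U.Characteristic := hU
  haveI hUn : U.Normal := inferInstance
  haveI : U.FiniteIndex := finiteIndex_of_isOpen U hUo
  set f := α.toMulEquiv.toMonoidHom with hf
  have hfs : Function.Surjective f := α.surjective
  set U' : Subgroup P' := U.map f with hU'
  set A' : Subgroup P' := A.map f with hA'
  have hU'o : IsOpen (U' : Set P') := isOpen_map α U hUo
  haveI hU'n : U'.Normal := hUn.map f hfs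
  have hU'c : U'.Characteristic := characteristic_map α.toMulEquiv hU
  haveI : U'.FiniteIndex := finiteIndex_of_isOpen U' hU'o
  have hGal' : ∀ B' : Subgroup P', U' ≤ B' → IsGaloisCovering B' U' := fun B' hB' =>
    ⟨hB', hU'o, Subgroup.isOpen_mono hB' hU'o, inferInstance⟩
  by_cases hAU : A ≤ U
  · -- trivial covering: the clause only says that there is a node
    have hAU' : A' ≤ U' := Subgroup.map_mono hAU
    rw [sup_eq_right.mpr hAU']
    obtain ⟨-, e, -, -⟩ := h
    obtain ⟨e'⟩ := hn ⟨e⟩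
    exact ⟨hGal' U' le_rfl, e', 1, sup_eq_right.mpr inf_le_left⟩
  · -- nontrivial cyclic covering: pass through "module-wise nodal" on both sides
    have hmw := (G.nodallyTotallyRamified_iff_modulewiseNodal hG0 hS A U hAc ⟨a, hA⟩ hAinf hU hUo
      inferInstance hAU).mp h
    obtain ⟨-, -, ⟨g, hg, hgen⟩, -, hedge⟩ := hmw
    -- the `H`-side data
    have hA'c : IsClosed (A' : Set P') := by
      rw [hA', Subgroup.coe_map]
      exact α.toHomeomorph.isClosedMap _ hAc
    have hA'cyc : ∃ a' : P', (Subgroup.zpowers a').topologicalClosure = A' :=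
      ⟨α a, by rw [hA', ← hA, map_topologicalClosure, MonoidHom.map_zpowers]; rfl⟩
    have hA'inf : (A' : Set P').Infinite := by
      rw [hA', Subgroup.coe_map]
      exact hAinf.image α.injective.injOn
    have hAU' : ¬ A' ≤ U' := fun hle => hAU (by
      have := Subgroup.comap_mono (f := f) hle
      rwa [hA', hU', Subgroup.comap_map_eq_self_of_injective α.injective,
        Subgroup.comap_map_eq_self_of_injective α.injective] at this)
    refine (H.nodallyTotallyRamified_iff_modulewiseNodal hH0 hS' A' U' hA'c hA'cyc hA'inf hU'c hU'o
      inferInstance hAU').mpr ⟨le_sup_right, inferInstance, ⟨f g, ?_, ?_⟩, ?_, ?_⟩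
    · rw [hA', hU', ← Subgroup.map_sup]
      exact Subgroup.mem_map_of_mem f hg
    · rw [hU', hA', ← MonoidHom.map_zpowers, ← Subgroup.map_sup, hgen, Subgroup.map_sup]
    · -- `cuspFil ≤ U'`: automatic for cyclic coverings of a noncuspidal datum
      have hgen' : U' ⊔ Subgroup.zpowers (f g) = A' ⊔ U' := by
        rw [hU', hA', ← MonoidHom.map_zpowers, ← Subgroup.map_sup, hgen, Subgroup.map_sup]
      exact H.cuspFil_le_of_cyclic hH0 hU'o hgen'
    · -- `U' · (inverse image of M^edge) = A' ⊔ U'`: transported by edge-wise filtration-preservation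
      have hBo : IsOpen ((A ⊔ U : Subgroup P) : Set P) := Subgroup.isOpen_mono le_sup_right hUo
      have key := congrArg (Subgroup.map f) hedge
      rw [Subgroup.map_sup, hf, hfp (A ⊔ U) hBo, Subgroup.map_sup] at key
      rw [hU', hA']
      exact key

/-- **Transport of the condition of [IUTchI] Rmk. 1.2.3 (v)**: under the hypotheses of
`nodalClause_map`, if `A ≤ Π_G` is closed, topologically cyclic, infinite, and `G_U → G_{A·U}` is
nodally totally ramified for every characteristic open `U`, then `α(A)` has the same four properties
in `Π_H`. [cite: Mochizuki2012, IUTchI Rmk 1.2.3(v) p.43] -/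
theorem nodalCond_map [CompactSpace P] [CompactSpace P'] {l : ℕ} (hS : G.Sigma = {l})
    (hS' : H.Sigma = {l}) (hG0 : G.graph.IsNoncuspidal) (hH0 : H.graph.IsNoncuspidal)
    (hn : Nonempty G.graph.N → Nonempty H.graph.N) (hfp : G.IsEdgewiseFiltrationPreserving H α)
    {A : Subgroup P} (h1 : IsClosed (A : Set P))
    (h2 : ∃ a : P, (Subgroup.zpowers a).topologicalClosure = A) (h3 : (A : Set P).Infinite)
    (h4 : ∀ U : Subgroup P, U.Characteristic → IsOpen (U : Set P) →
      G.IsNodallyTotallyRamified (A ⊔ U) U) :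
    IsClosed ((A.map α.toMulEquiv.toMonoidHom : Subgroup P') : Set P') ∧
      (∃ a' : P', (Subgroup.zpowers a').topologicalClosure = A.map α.toMulEquiv.toMonoidHom) ∧
      ((A.map α.toMulEquiv.toMonoidHom : Subgroup P') : Set P').Infinite ∧
      ∀ U' : Subgroup P', U'.Characteristic → IsOpen (U' : Set P') →
        H.IsNodallyTotallyRamified (A.map α.toMulEquiv.toMonoidHom ⊔ U') U' := by
  obtain ⟨a, ha⟩ := h2
  refine ⟨?_, ⟨α a, ?_⟩, ?_, fun U' hU' hU'o => ?_⟩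
  · rw [Subgroup.coe_map]
    exact α.toHomeomorph.isClosedMap _ h1
  · rw [← ha, map_topologicalClosure, MonoidHom.map_zpowers]
    rfl
  · rw [Subgroup.coe_map]
    exact h3.image α.injective.injOn
  · set U : Subgroup P := U'.comap α.toMulEquiv.toMonoidHom with hU
    have hUmap : U.map α.toMulEquiv.toMonoidHom = U' :=
      Subgroup.map_comap_eq_self_of_surjective α.surjective U'
    have hUchar : U.Characteristic := by
      have := characteristic_map α.symm.toMulEquiv hU'
      rw [map_symm_eq_comap α] at this
      exact this
    have hUo : IsOpen (U : Set P) := isOpen_comap α U' hU'o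
    have key := nodalClause_map hS hS' hG0 hH0 hn hfp h1 ha h3 hUchar hUo (h4 U hUchar hUo)
    rwa [hUmap] at key

/-! ### Nodal goes to nodal; Theorem 1.6 (ii)'s edge-like step -/

/-- **Nodal goes to nodal**: granting the characterization of nodal subgroups of [IUTchI] Rmk.
1.2.3 (v) (first conjunct of the named fact `NodalEdgeLikeCharacterization`) for `G` and for `H`,
an edge-wise filtration-preserving `α` between noncuspidal data with `Σ = {l}`, compact groups and
"`G` has a node iff `H` does" carries nodal subgroups of `Π_G` to nodal subgroups of `Π_H`.
[cite: MochizukiCombGC2007, Thm 1.6(ii) p.14] -/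
theorem isNodal_map_of_isEdgewiseFiltrationPreserving [CompactSpace P] [CompactSpace P'] {l : ℕ}
    (hS : G.Sigma = {l}) (hS' : H.Sigma = {l}) (hG0 : G.graph.IsNoncuspidal)
    (hH0 : H.graph.IsNoncuspidal) (hn : Nonempty G.graph.N ↔ Nonempty H.graph.N)
    (hG : G.NodalEdgeLikeCharacterization) (hH : H.NodalEdgeLikeCharacterization)
    (hfp : G.IsEdgewiseFiltrationPreserving H α) {A : Subgroup P} (hA : G.IsNodal A) :
    H.IsNodal (A.map α.toMulEquiv.toMonoidHom) := by
  have hGl := (hG hG0 l hS).1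
  have hHl := (hH hH0 l hS').1
  dsimp only at hGl hHl
  obtain ⟨⟨h1, h2, h3, h4⟩, hmax⟩ := (hGl A).mp hA
  refine (hHl _).mpr ⟨nodalCond_map hS hS' hG0 hH0 hn.mp hfp h1 h2 h3 h4, fun B' hB' hAB' => ?_⟩
  obtain ⟨k1, k2, k3, k4⟩ := hB'
  have hback := nodalCond_map (α := α.symm) hS' hS hH0 hG0 hn.mpr hfp.symm k1 k2 k3 k4
  rw [map_symm_eq_comap α] at hback
  obtain ⟨j1, j2, j3, j4⟩ := hback
  have hAB : A ≤ B'.comap α.toMulEquiv.toMonoidHom := fun x hx =>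
    Subgroup.mem_comap.mpr (hAB' (Subgroup.mem_map_of_mem _ hx))
  have hEq := hmax _ ⟨j1, j2, j3, j4⟩ hAB
  rw [hEq]
  exact Subgroup.map_comap_eq_self_of_surjective α.surjective B'

/-- **[CombGC] Theorem 1.6 (ii), the step "edge-wise filtration-preserving ⟹ group-theoretically
edge-like"** (p. 14: "But by Remark 1.4.4, the assumption that `α` is edge-wise
filtration-preserving implies that `α` is group-theoretically edge-like"), REDUCED over the
interface to the characterization of nodal subgroups of [IUTchI] Rmk. 1.2.3 (v) (named fact
`NodalEdgeLikeCharacterization`, for `G` and for `H`): for noncuspidal `G`, `H` with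
`Σ_G = Σ_H = {l}`, compact `Π_G`, `Π_H`, and "`G` has a node iff `H` has a node", an edge-wise
filtration-preserving `α` is group-theoretically edge-like (edge-like = nodal for noncuspidal data).
[cite: MochizukiCombGC2007, Thm 1.6(ii) p.14] -/
theorem isGroupTheoreticallyEdgeLike_of_isEdgewiseFiltrationPreserving [CompactSpace P]
    [CompactSpace P'] {l : ℕ} (hS : G.Sigma = {l}) (hS' : H.Sigma = {l})
    (hG0 : G.graph.IsNoncuspidal) (hH0 : H.graph.IsNoncuspidal)
    (hn : Nonempty G.graph.N ↔ Nonempty H.graph.N) (hG : G.NodalEdgeLikeCharacterization)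
    (hH : H.NodalEdgeLikeCharacterization) (hfp : G.IsEdgewiseFiltrationPreserving H α) :
    G.IsGroupTheoreticallyEdgeLike H α := by
  refine ⟨fun A hA => ?_, fun B hB => ?_⟩
  · rcases hA with hA | hA
    · exact Or.inl (isNodal_map_of_isEdgewiseFiltrationPreserving hS hS' hG0 hH0 hn hG hH hfp hA)
    · exact absurd hA (G.not_isCuspidal_of_isNoncuspidal hG0 A)
  · rcases hB with hB | hB
    · refine ⟨B.comap α.toMulEquiv.toMonoidHom, Or.inl ?_,
        Subgroup.map_comap_eq_self_of_surjective α.surjective B⟩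
      have := isNodal_map_of_isEdgewiseFiltrationPreserving (α := α.symm) hS' hS hH0 hG0 hn.symm
        hH hG hfp.symm hB
      rwa [map_symm_eq_comap α] at this
    · exact absurd hB (H.not_isCuspidal_of_isNoncuspidal hH0 B)

/-! ### "In particular, `α` induces a verticially filtration-preserving `β : Π^unr_G ⥲ Π^unr_H`" -/

section Unr

variable (G)

/-- For a `Π^unr_G`-covering (open `U ⊇ Ker(Π_G ↠ Π^unr_G)`), the inverse image of `M^vert_{G_U}`
contains that kernel: every conjugate of an edge-like subgroup lies in `U` and in a verticial subgroup,
hence in a verticial subgroup of `Π_{G_U}`. [cite: MochizukiCombGC2007, Def 1.1(ii) p.7] -/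
theorem unrKer_le_vertFil {U : Subgroup P} (hU : G.unrKer ≤ U) : G.unrKer ≤ G.vertFil U := by
  refine Subgroup.topologicalClosure_minimal _ ?_ (Subgroup.isClosed_topologicalClosure _)
  refine (Subgroup.closure_le _).mpr fun x hx => ?_
  obtain ⟨a, ha, hax⟩ := Group.mem_conjugatesOfSet_iff.mp hx
  obtain ⟨g, rfl⟩ := isConj_iff.mp hax
  -- `a` lies in a representative edge-like subgroup `E`
  obtain ⟨E, hE, haE⟩ : ∃ E, G.IsEdgeLike E ∧ a ∈ E := by
    rcases ha with ha | ha
    · obtain ⟨c, hac⟩ := Set.mem_iUnion.mp ha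
      exact ⟨G.cuspGp c, Or.inr ⟨c, 1, by rw [one_smul]⟩, hac⟩
    · obtain ⟨e, hae⟩ := Set.mem_iUnion.mp ha
      exact ⟨G.nodeGp e, Or.inl ⟨e, 1, by rw [one_smul]⟩, hae⟩
  -- its conjugate by `g` is again edge-like, lies in `unrKer ≤ U` and in a verticial subgroup
  have hE' : G.IsEdgeLike (ConjAct.toConjAct g • E) := by
    rcases hE with ⟨e, γ, rfl⟩ | ⟨c, γ, rfl⟩
    · exact Or.inl ⟨e, ConjAct.toConjAct g * γ, by rw [mul_smul]⟩
    · exact Or.inr ⟨c, ConjAct.toConjAct g * γ, by rw [mul_smul]⟩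
  have hxE' : g * a * g⁻¹ ∈ ConjAct.toConjAct g • E :=
    (Subgroup.mem_smul_pointwise_iff_exists _ _ _).mpr
      ⟨a, haE, by rw [ConjAct.smul_def, ConjAct.ofConjAct_toConjAct]⟩
  obtain ⟨B, hB, hE'B⟩ := G.exists_isVerticial_ge_of_isEdgeLike hE'
  have hxU : g * a * g⁻¹ ∈ U := hU (G.le_unrKer_of_isEdgeLike hE' hxE')
  have hmem : g * a * g⁻¹ ∈ (⟨U ⊓ B, B, hB, rfl⟩ : {A : Subgroup P // G.IsVerticialIn U A}).1 :=
    Subgroup.mem_inf.mpr ⟨hxU, hE'B hxE'⟩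
  show g * a * g⁻¹ ∈ G.vertFil U
  unfold vertFil
  exact Subgroup.le_topologicalClosure _
    (Subgroup.mem_sup_right (Subgroup.mem_iSup_of_mem ⟨U ⊓ B, B, hB, rfl⟩ hmem))

variable {G}

/-- The transport `unrTransport β` along the isomorphism `β` induced by `α` over the projections is
`S ↦ α(S) · Ker(Π_H ↠ Π^unr_H)`. [cite: MochizukiCombGC2007, Def 1.4(iii) p.10] -/
theorem unrTransport_eq_map_sup {β : (P ⧸ G.unrKer) ≃ₜ* (P' ⧸ H.unrKer)}
    (hβ : ∀ x : P, β (QuotientGroup.mk x) = QuotientGroup.mk (α x)) (S : Subgroup P) :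
    G.unrTransport H β S = S.map α.toMulEquiv.toMonoidHom ⊔ H.unrKer := by
  unfold unrTransport
  have hcomp : β.toMulEquiv.toMonoidHom.comp (QuotientGroup.mk' G.unrKer) =
      (QuotientGroup.mk' H.unrKer).comp α.toMulEquiv.toMonoidHom := MonoidHom.ext hβ
  rw [Subgroup.map_map, hcomp, ← Subgroup.map_map, Subgroup.comap_map_eq, QuotientGroup.ker_mk']

/-- **[CombGC] proof of Thm. 1.6 (ii), "In particular, `α` induces a verticially
filtration-preserving isomorphism `Π^unr_G ⥲ Π^unr_H`"** (p. 14), kernel form: if `α` carries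
`Ker(Π_G ↠ Π^unr_G)` onto `Ker(Π_H ↠ Π^unr_H)` (e.g. `α` group-theoretically edge-like,
`map_unrKer_of_isGroupTheoreticallyEdgeLike`) and `α` is verticially filtration-preserving, then the
induced `β` (`exists_unrQuotient_equiv`) is verticially filtration-preserving in the sense of Def. 1.4
(iii) for `β`. [cite: MochizukiCombGC2007, Thm 1.6(ii) p.14] -/
theorem isUnrVerticiallyFiltrationPreserving_of_isVerticiallyFiltrationPreserving
    (hker : G.unrKer.map α.toMulEquiv.toMonoidHom = H.unrKer)
    {β : (P ⧸ G.unrKer) ≃ₜ* (P' ⧸ H.unrKer)}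
    (hβ : ∀ x : P, β (QuotientGroup.mk x) = QuotientGroup.mk (α x))
    (h : G.IsVerticiallyFiltrationPreserving H α) : G.IsUnrVerticiallyFiltrationPreserving H β := by
  intro U hUo hUker
  have hUker' : H.unrKer ≤ U.map α.toMulEquiv.toMonoidHom := hker ▸ Subgroup.map_mono hUker
  rw [unrTransport_eq_map_sup hβ, unrTransport_eq_map_sup hβ, h U hUo, sup_eq_left.mpr hUker',
    sup_eq_left]
  exact H.unrKer_le_vertFil hUker'

/-- **The two filtration hypotheses of Thm. 1.6 (ii) hand over to Thm. 1.6 (iii)** (p. 14: "α is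
group-theoretically edge-like. In particular, `α` induces a verticially filtration-preserving
isomorphism `Π^unr_G ⥲ Π^unr_H` … it suffices to verify assertion (iii)"): under the hypotheses of
`isGroupTheoreticallyEdgeLike_of_isEdgewiseFiltrationPreserving`, a GRAPHICALLY filtration-preserving
`α` is group-theoretically edge-like and induces a verticially filtration-preserving `β` over the
projections. [cite: MochizukiCombGC2007, Thm 1.6(ii) p.14] -/
theorem exists_unr_verticiallyFiltrationPreserving_of_isGraphicallyFiltrationPreserving
    [CompactSpace P] [CompactSpace P'] {l : ℕ} (hS : G.Sigma = {l}) (hS' : H.Sigma = {l})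
    (hG0 : G.graph.IsNoncuspidal) (hH0 : H.graph.IsNoncuspidal)
    (hn : Nonempty G.graph.N ↔ Nonempty H.graph.N) (hG : G.NodalEdgeLikeCharacterization)
    (hH : H.NodalEdgeLikeCharacterization) (hfp : G.IsGraphicallyFiltrationPreserving H α) :
    G.IsGroupTheoreticallyEdgeLike H α ∧
      ∃ β : (P ⧸ G.unrKer) ≃ₜ* (P' ⧸ H.unrKer),
        (∀ x : P, β (QuotientGroup.mk x) = QuotientGroup.mk (α x)) ∧
          G.IsUnrVerticiallyFiltrationPreserving H β := by
  have hel := isGroupTheoreticallyEdgeLike_of_isEdgewiseFiltrationPreserving hS hS' hG0 hH0 hn hG hH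
    hfp.2
  have hker := map_unrKer_of_isGroupTheoreticallyEdgeLike hel
  obtain ⟨β, hβ⟩ := exists_unrQuotient_equiv hker
  exact ⟨hel, β, hβ,
    isUnrVerticiallyFiltrationPreserving_of_isVerticiallyFiltrationPreserving hker hβ hfp.1⟩

end Unr

/-! ### Assembly: what Theorem 1.6 (ii) ⇐ still rests on, for noncuspidal sturdy data -/

section Assembly

/-- **[CombGC] Theorem 1.6 (ii) ⇐ for noncuspidal sturdy data with `Σ = {l}`, ASSEMBLED from the
printed route** (p. 14: "… we may assume that `G`, `H` are noncuspidal and sturdy … `Σ = {l}`. Now by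
Proposition 1.5, (ii), it suffices to prove that `α` is group-theoretically edge-like and
group-theoretically verticial. But by Remark 1.4.4 … `α` is group-theoretically edge-like. In
particular, `α` induces a verticially filtration-preserving isomorphism `Π^unr_G ⥲ Π^unr_H`. Now to
prove that `α` is group-theoretically verticial, it suffices to prove … that `α` induces a functorial
bijection between the sets of vertices … it suffices to verify assertion (iii)"), with every
remaining input BY NAME or displayed: the nodal characterization ([IUTchI] Rmk. 1.2.3 (v)) for `G`,
`H`; Thm. 1.6 (iii) for the induced `β` (typed predicate `UnrVerticiallyFiltrationPreservingIffVerticial`);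
the recovery of verticial subgroups of `Π` from the group-theoretically verticial `β` ("stabilizers of
vertices", p. 14 / [IUTchI] Rmk. 1.2.3 (iv) — displayed as `hrec`, an interface-functoriality input);
and Prop. 1.5 (ii) (typed predicate `GraphicIffEdgeLikeVerticial`).
[cite: MochizukiCombGC2007, Thm 1.6(ii) p.14] -/
theorem isGraphic_of_isGraphicallyFiltrationPreserving_of_inputs [CompactSpace P] [CompactSpace P']
    {l : ℕ} (hS : G.Sigma = {l}) (hS' : H.Sigma = {l}) (hG0 : G.graph.IsNoncuspidal)
    (hH0 : H.graph.IsNoncuspidal) (hGs : G.IsSturdy) (hHs : H.IsSturdy)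
    (hn : Nonempty G.graph.N ↔ Nonempty H.graph.N) (hG : G.NodalEdgeLikeCharacterization)
    (hH : H.NodalEdgeLikeCharacterization)
    (h3 : ∀ β : (P ⧸ G.unrKer) ≃ₜ* (P' ⧸ H.unrKer),
      (∀ x : P, β (QuotientGroup.mk x) = QuotientGroup.mk (α x)) →
        G.UnrVerticiallyFiltrationPreservingIffVerticial H β)
    (hrec : ∀ β : (P ⧸ G.unrKer) ≃ₜ* (P' ⧸ H.unrKer),
      (∀ x : P, β (QuotientGroup.mk x) = QuotientGroup.mk (α x)) →
        G.IsUnrGroupTheoreticallyVerticial H β → G.IsGroupTheoreticallyVerticial H α)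
    (hP15 : G.GraphicIffEdgeLikeVerticial H α) (hfp : G.IsGraphicallyFiltrationPreserving H α) :
    G.IsGraphic H α := by
  obtain ⟨hel, β, hβ, hβfp⟩ :=
    exists_unr_verticiallyFiltrationPreserving_of_isGraphicallyFiltrationPreserving hS hS' hG0 hH0 hn
      hG hH hfp
  have hv : G.IsGroupTheoreticallyVerticial H α := hrec β hβ ((h3 β hβ hGs hHs).mp hβfp)
  exact hP15.1.mpr ⟨hel, hv⟩

/-- **[CombGC] Theorem 1.6 (ii) as typed** (`GraphicIffGraphicallyFiltrationPreserving G H α`) for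
noncuspidal sturdy data with `Σ = {l}` and compact groups, REDUCED to the inputs listed in
`isGraphic_of_isGraphicallyFiltrationPreserving_of_inputs` ("⇒" is seat abc-iut-L5-t6's
`isGraphicallyFiltrationPreserving_of_isGraphic`). [cite: MochizukiCombGC2007, Thm 1.6(ii) p.13] -/
theorem graphicIffGraphicallyFiltrationPreserving_of_inputs [CompactSpace P] [CompactSpace P']
    {l : ℕ} (hS : G.Sigma = {l}) (hS' : H.Sigma = {l}) (hG0 : G.graph.IsNoncuspidal)
    (hH0 : H.graph.IsNoncuspidal) (hGs : G.IsSturdy) (hHs : H.IsSturdy)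
    (hn : Nonempty G.graph.N ↔ Nonempty H.graph.N) (hG : G.NodalEdgeLikeCharacterization)
    (hH : H.NodalEdgeLikeCharacterization)
    (h3 : ∀ β : (P ⧸ G.unrKer) ≃ₜ* (P' ⧸ H.unrKer),
      (∀ x : P, β (QuotientGroup.mk x) = QuotientGroup.mk (α x)) →
        G.UnrVerticiallyFiltrationPreservingIffVerticial H β)
    (hrec : ∀ β : (P ⧸ G.unrKer) ≃ₜ* (P' ⧸ H.unrKer),
      (∀ x : P, β (QuotientGroup.mk x) = QuotientGroup.mk (α x)) →
        G.IsUnrGroupTheoreticallyVerticial H β → G.IsGroupTheoreticallyVerticial H α)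
    (hP15 : G.GraphicIffEdgeLikeVerticial H α) :
    G.GraphicIffGraphicallyFiltrationPreserving H α :=
  ⟨G.isGraphicallyFiltrationPreserving_of_isGraphic H α,
    isGraphic_of_isGraphicallyFiltrationPreserving_of_inputs hS hS' hG0 hH0 hGs hHs hn hG hH h3 hrec
      hP15⟩

end Assembly

end PSCDatum

end Literature.AnabelianGeometry.SemiGraphs

end
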